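import Mathlib

set_option linter.dupNamespace false

/-!
# `ThinPackings`, line `label-weighted-stpp-debordering`: frame tiles live in the cross-polytope

Crux `stmt-MatrixMultiplication-10595` (`Summit.…Theses.ThinBlockAlpha.ThinPackings`), registered design stub
`stub_generalFrameDesigns` (orthogonal frames in the box `[-b, b]^D`).  A NECESSITY on its witnesses, sharpening
the tile-box count `L·N² ≤ (4b+1)^D` (drefuter, `FrameDesignBoxCount`): a tile `v = c − a` of an orthogonal pair
`a ⊥ c` of box vectors has `ℓ¹`-norm at most `b·D` — HALF the diameter of the tile box `[-2b, 2b]^D` in `ℓ¹` —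
because `s = c + a` has the same Euclidean norm as `v` (Pythagoras) while `|s_t| ≤ 2b − |v_t|` coordinatewise
(`|x + y| + |x − y| = 2·max(|x|, |y|) ≤ 2b`), so `‖v‖₂² = ‖s‖₂² ≤ Σ_t (2b − |v_t|)²`, i.e. `4b·‖v‖₁ ≤ 4b²·D`.
Consequently the packed tile set of any frame design lies in `{v ∈ [-2b,2b]^D : ‖v‖₁ ≤ bD}`, roughly half of the
tile box for `b ≫ √D` and an exponentially small fraction `≈ e^{-cD/b²}·(4b+1)^D` of it for `b = O(√D)`; the same
holds for the `B − A` and `B − C` difference vectors.  Lead prover-line-stmt-MatrixMultiplication-10595-0, 2026-08-16.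
-/

namespace Summit.MatrixMultiplication.MatrixMultiplication.Theorems.ThinPackings

open Finset

/-- For integers `x, y` of absolute value `≤ b`: `|x + y| ≤ 2b − |x − y|`
(`|x + y| + |x − y| = 2·max(|x|,|y|)`). [folklore] -/
theorem FrameTiles.abs_add_le_two_mul_sub_abs_sub {x y : ℤ} {b : ℤ} (hx : |x| ≤ b) (hy : |y| ≤ b) :
    |x + y| ≤ 2 * b - |x - y| := by
  rw [abs_le] at hx hy
  rcases abs_cases (x + y) with ⟨h1, _⟩ | ⟨h1, _⟩ <;>
    rcases abs_cases (x - y) with ⟨h2, _⟩ | ⟨h2, _⟩ <;> omega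

/-- **Frame tiles live in the cross-polytope.**  If `a, c ∈ ℤ^D` lie in the box `[-b, b]^D` and are orthogonal,
then the tile `c − a` has `ℓ¹`-norm at most `b·D`: `Σ_t |c t − a t| ≤ b·D`.  Registered sub-goal
`frameTiles_sum_abs_sub_le` of crux stmt-MatrixMultiplication-10595 (necessity on witnesses of
`stub_generalFrameDesigns`). [new, elementary] -/
theorem frameTiles_sum_abs_sub_le :
    ∀ (D b : ℕ) (a c : Fin D → ℤ), (∀ t, |a t| ≤ (b : ℤ)) → (∀ t, |c t| ≤ (b : ℤ)) → a ⬝ᵥ c = 0 →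
      ∑ t, |c t - a t| ≤ (b : ℤ) * D := by
  intro D b a c ha hc horth
  -- Pythagoras: ‖c - a‖² = ‖c + a‖²
  have hpy : ∑ t, (c t - a t) ^ 2 = ∑ t, (c t + a t) ^ 2 := by
    have h1 : ∑ t, (c t - a t) ^ 2 = ∑ t, (c t ^ 2 + a t ^ 2) - 2 * (a ⬝ᵥ c) := by
      unfold dotProduct
      rw [Finset.mul_sum, ← Finset.sum_sub_distrib]
      exact Finset.sum_congr rfl fun t _ => by ring
    have h2 : ∑ t, (c t + a t) ^ 2 = ∑ t, (c t ^ 2 + a t ^ 2) + 2 * (a ⬝ᵥ c) := by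
      unfold dotProduct
      rw [Finset.mul_sum, ← Finset.sum_add_distrib]
      exact Finset.sum_congr rfl fun t _ => by ring
    rw [h1, h2, horth]; ring
  -- coordinatewise `(c + a)² ≤ (2b − |c − a|)²`
  have hcoord : ∀ t, (c t + a t) ^ 2 ≤ (2 * (b : ℤ) - |c t - a t|) ^ 2 := by
    intro t
    have h := FrameTiles.abs_add_le_two_mul_sub_abs_sub (hc t) (ha t)
    have h0 : 0 ≤ |c t + a t| := abs_nonneg _
    calc (c t + a t) ^ 2 = |c t + a t| ^ 2 := (sq_abs _).symm
      _ ≤ (2 * (b : ℤ) - |c t - a t|) ^ 2 := pow_le_pow_left₀ h0 h 2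
  have hsum : ∑ t, (c t - a t) ^ 2 ≤ ∑ t, (2 * (b : ℤ) - |c t - a t|) ^ 2 := by
    rw [hpy]; exact Finset.sum_le_sum fun t _ => hcoord t
  -- expand: Σ (2b − |v|)² = 4b²D − 4b Σ|v| + Σ |v|², and Σ |v|² = Σ v²
  have hexp : ∑ t, (2 * (b : ℤ) - |c t - a t|) ^ 2 =
      4 * (b : ℤ) ^ 2 * D - 4 * b * ∑ t, |c t - a t| + ∑ t, (c t - a t) ^ 2 := by
    have : ∀ t, (2 * (b : ℤ) - |c t - a t|) ^ 2 = 4 * (b : ℤ) ^ 2 - 4 * b * |c t - a t| + (c t - a t) ^ 2 :=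
      fun t => by rw [← sq_abs (c t - a t)]; ring
    rw [Finset.sum_congr rfl fun t _ => this t, Finset.sum_add_distrib, Finset.sum_sub_distrib,
      Finset.sum_const, card_univ, Fintype.card_fin, Finset.mul_sum, nsmul_eq_mul]
    ring
  rw [hexp] at hsum
  have hS0 : 0 ≤ ∑ t, |c t - a t| := Finset.sum_nonneg fun t _ => abs_nonneg _
  rcases Nat.eq_zero_or_pos b with hb | hb
  · -- b = 0: everything vanishes
    subst hb
    have hz : ∀ t, c t - a t = 0 := by
      intro t
      have h1 := ha t; have h2 := hc t
      simp only [Nat.cast_zero, abs_nonpos_iff] at h1 h2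
      rw [h1, h2, sub_zero]
    simp [hz]
  · have hb' : (0 : ℤ) < b := by exact_mod_cast hb
    nlinarith

end Summit.MatrixMultiplication.MatrixMultiplication.Theorems.ThinPackings
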